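import Summits.QuantumFields.BalabanUV.T4Continuum.Support.NE7SliceLetterHodgeReductionSplit
import Summits.QuantumFields.BalabanUV.T4Continuum.Support.NE7CombGenerator
import Summits.QuantumFields.BalabanUV.T4Continuum.Support.NE7TensionRadiusOfFluxGradient
import HarnessLib

/-!
# NE7SliceLetterCombReduction — (c₂) DISCHARGED BY GAUGE CHOICE: F142 with `S_L :=` the block-COMB slice `{Y skew : Y = 0 on every in-block comb bond}`; the
# decomposition and BOTH sup bounds (`C_ξ = d(M−1)`, `C_H = 2d(M−1)`) come from F143's comb generator, so the homogeneous slice-solver letter (L2)ʰ on ALL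
# W-tangent fields follows from ONE letter — (c₁) on the comb slice — plus the background's tension datum, with
# `K_X′ = (1 + 2d(M−1))·K_X + 2(x + K_G·τ_W)·d(M−1)` (file 74 of the curved (APE): (c₂) BY GAUGE CHOICE, bookkeeping half)

Cell `pub-balaban`, rung (B)+1 sub-cell t4, lineage `b2b-balaban-t4-ne7-p1` (CRUX PROVER NE7 #1 = OWNER of row NE7), generation 81; memo
`t4/b2b-balaban-t4-ne7-p1-g81/COMB-SLICE.md`.  File F144 = F142 `NE7SliceLetterHodgeReductionSplit.sliceLetter_hom_of_hodge_split` ∘ F143 `NE7CombGenerator`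
(`exists_combSolve` + `skew∕periodic∕norm_le∕norm_gaugeDir_le∕comb_vanish _of_combSolve`) ∘ F141 `NE7TensionRadiusOfFluxGradient.abs_dAction_le_of_fluxGrad`, BY NAME.
WHY.  g80 left the curved (APE) END (`NE7ApeCurvedRepRoadBGradientClassH`, p586320) consuming (L2)ʰ, and (L2)ʰ ⇐ (c₁)^∞ on row NE3's `T_♮(W)` + (c₂)^∞ = two ℓ^∞ bounds of
the `T_♮(W)` projection (order −1 `C_ξ`, order 0 `C_H`) whose honest sizes are UNKNOWN and carry two located risks (memo g80 §7: the class is PINNED at the corners —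
spikes, `C_H ≍ M`; §8: `∇Δ⁻¹div` is Calderón–Zygmund — `log M`).  F137 had left the slice `S_L` FREE.  Choosing the block-comb slice makes (c₂) a KINEMATIC FACT with
explicit level-free, volume-free constants at every unitary background (F143), so after THIS file the END's slice-solver input is EXACTLY ONE displayed letter:
(c₁)^{comb} — for `X` skew, `(N·M)`-periodic, W-tangent (`dirIter L (j+1) W X = 0`) and vanishing on the in-block comb bonds, `‖curl_W X‖_∞ ≤ K_G·g + K_X·‖X‖_∞`
whenever its slice functional is `≤ g‖·‖₁` — and the tension datum `τ_W` (itself `= d·g_W + 12·#Plane·x²` from the flux-gradient radius, F141; §3).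
CURRENCY (memo §2, for the desk): the END needs `K_X′·(α₀ + m) = O(δ₁∕M²)` with `α₀ ≍ δ∕M`; here `K_X′ = (1 + 2d(M−1))K_X + 2d(M−1)(x + K_G τ_W)`, so (i) the gauge
summand costs `2d(M−1)(b + K d c + 12#Plane b²∕M)∕M² · δ∕M ≍ 2d(b + Kdc)·δ∕M²` — closing order iff `2d(b + Kdc)δ ≲ δ₁` (a smallness condition on the class radii `b`, `c`
against the solver constant `K`), and (ii) the slice summand costs `≈ 2dM·K_X·δ∕M`, closing iff `K_X ≲ δ₁∕(2dδ·M²)`: on the comb slice the slope must be ONE POWER OF `M`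
SMALLER than on a Landau slice (the comb representative of a smooth field is rougher by a factor `M`) — the same physical statement, restated; nothing analytic is
claimed solved.  At the flat background `K_X = 0` works on every slice (F138).
WHAT ([folklore]; 0 def, 0 sorry).  §1 `combSlice_hodge` — F142's hypothesis (c₂) for the comb slice, DISCHARGED (every `d ≥ 1`, `L ≥ 1`, unitary periodic `W` of the
class).  §2 **`sliceLetter_hom_of_comb`** — (L2)ʰ on all W-tangent skew periodic fields ⇐ (c₁)^{comb} + tension letter `τ_W`.  §3 **`sliceLetter_hom_of_comb_fluxGrad`** —
the same with `τ_W := d·g_W + 12·#Plane·x²` discharged from the flux-gradient radius `g_W` (F141; `x ≤ 1∕4`).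
HONEST FRAMING (page 1): bookkeeping over ONE displayed letter at one configuration; (c₁)^{comb} is NOT proved or claimed (by F137 it is implied by (c₁) on `T_♮(W)` +
(c₂)^∞ there, so no analytic content has been removed from the programme — only from the END's hypothesis list); nothing of Bałaban's asserted; (APE) on curved data NOT
proved; NOT ONE-STEP, NOT NE7; spine 0∕9; finite T⁴ rung (B)+1 — NOT infinite volume, NOT mass gap, NOT `BetaPertH`, NOT Clay.  Continuum YM on T⁴ ⇐ BetaPertH ∧ nine
spine estimates (0/9 proved); BetaPertH ⇐ (D1) ∧ (D4) ∧ CAP+tail; G-an2-4 gates asym, D1 and NE2/3/4.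
-/

set_option autoImplicit false

open scoped BigOperators Matrix.Norms.L2Operator
open NormedSpace Finset

namespace Summit.QuantumFields.BalabanUV.T4Continuum.NE7SliceLetterCombReduction

open Literature.MathematicalPhysics.QuantumFieldTheory.Balaban1983to89
open B7Prop1Explicit B7Prop2Explicit UnitaryModel
open T4AveragingDeficitWall (Ad IsUnitaryCfg IsSkewDir SmallField curlAt dirL1 flux covGrad)
open T4AveragingDeficitWallBoundary (IsPeriodicCfg periodBox)
open AveragingDeficitPeriodicCounting (IsPeriodicDir)
open AveragingDeficitMultiLevelPrep (LevelSmall)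
open MinimalActionLevels (perWin)
open BlockAveragePushDirGauge (gaugeDir)
open NE3HessForm (hess dAction)
open NE3TangentCovariantTower (dirIter)
open NE7ExactCurrent (isSkewDir_gaugeDir)
open SkeletonLattice (cmod)
open NE7SliceLetterHodgeReductionSplit (sliceLetter_hom_of_hodge_split)
open NE7CombGenerator (exists_combSolve skew_of_combSolve periodic_of_combSolve norm_le_of_combSolve norm_gaugeDir_le_of_combSolve
  comb_vanish_of_combSolve)
open NE7TensionRadiusOfFluxGradient (abs_dAction_le_of_fluxGrad)

noncomputable section

variable {d : ℕ} {n : Type*} [Fintype n] [DecidableEq n]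

/-! ## §1 (c₂) for the comb slice, discharged -/

/-- **F142's (c₂) FOR THE BLOCK-COMB SLICE — A THEOREM** (`d ≥ 1`, `L ≥ 1`, `M = L^{j+1}`, `W` unitary `(N·M)`-periodic): every skew `(N·M)`-periodic `X` (tangency is not
even needed) has a skew `(N·M)`-periodic CORNER-TRIVIAL generator `ξ` with `X − gaugeDir W ξ` skew and vanishing on every in-block comb bond, `‖ξ‖_∞ ≤ d(M−1)·R` and
`‖gaugeDir W ξ‖_∞ ≤ 2d(M−1)·R` for every sup bound `R` of `X` — F143's comb generator. [folklore] -/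
theorem combSlice_hodge (hd : 1 ≤ d) {L N : ℕ} (hL : 1 ≤ L) (j : ℕ)
    {W : Site d → Fin d → (Matrix n n ℂ)ˣ} (hWu : IsUnitaryCfg W) (hWP : IsPeriodicCfg W ((N * L ^ (j + 1) : ℕ) : ℤ))
    (X : Site d → Fin d → Matrix n n ℂ) (hXs : IsSkewDir X) (hXP : IsPeriodicDir X ((N * L ^ (j + 1) : ℕ) : ℤ)) :
    ∃ ξ : Site d → Matrix n n ℂ, (∀ y, ξ y ∈ skewAdjoint (Matrix n n ℂ)) ∧
      (∀ (y : Site d) (i : Fin d), ξ (y + ((N * L ^ (j + 1) : ℕ) : ℤ) • e i) = ξ y) ∧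
      (∀ w : Site d, ξ (((L : ℤ) ^ (j + 1)) • w) = 0) ∧
      (fun y κ => X y κ - gaugeDir W ξ y κ) ∈
        {Y : Site d → Fin d → Matrix n n ℂ | IsSkewDir Y ∧ ∀ (z : Site d) (μ : Fin d), (∀ κ, κ < μ → cmod (L ^ (j + 1)) z κ = 0) →
          cmod (L ^ (j + 1)) z μ + 1 < ((L ^ (j + 1) : ℕ) : ℤ) → Y z μ = 0} ∧
      (∀ R : ℝ, (∀ y κ', ‖X y κ'‖ ≤ R) → ∀ y : Site d, ‖ξ y‖ ≤ ((d : ℝ) * ((L : ℝ) ^ (j + 1) - 1)) * R) ∧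
      ∀ R : ℝ, (∀ y κ', ‖X y κ'‖ ≤ R) → ∀ (y : Site d) (κ : Fin d), ‖gaugeDir W ξ y κ‖ ≤ (2 * ((d : ℝ) * ((L : ℝ) ^ (j + 1) - 1))) * R := by
  have hM : 1 ≤ L ^ (j + 1) := Nat.one_le_pow _ _ hL
  have hcast : ((L : ℤ) ^ (j + 1)) = ((L ^ (j + 1) : ℕ) : ℤ) := by push_cast; ring
  have hcastR : (((L ^ (j + 1) : ℕ) : ℝ)) = (L : ℝ) ^ (j + 1) := by push_cast; ring
  obtain ⟨ξ, hξ0, hsol⟩ := exists_combSolve W hM X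
  have hξs : ∀ y, ξ y ∈ skewAdjoint (Matrix n n ℂ) := skew_of_combSolve hM hξ0 hsol hWu (fun z μ _ _ => hXs z μ)
  have hR0 : ∀ R : ℝ, (∀ (y : Site d) (κ' : Fin d), ‖X y κ'‖ ≤ R) → 0 ≤ R := fun R hR => (norm_nonneg _).trans (hR 0 ⟨0, hd⟩)
  refine ⟨ξ, hξs, periodic_of_combSolve hM hξ0 hsol hWP hXP, fun w => by rw [hcast]; exact hξ0 w, ⟨?_, ?_⟩, ?_, ?_⟩
  · exact fun y κ => (skewAdjoint _).sub_mem (hXs y κ) (isSkewDir_gaugeDir hWu hξs y κ)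
  · exact fun z μ hlow hin => comb_vanish_of_combSolve hsol z μ hlow hin
  · intro R hR y
    have h := norm_le_of_combSolve hM hξ0 hsol hWu (hR0 R hR) (fun z μ _ _ => hR z μ) y
    rwa [hcastR] at h
  · intro R hR y κ
    have h := norm_gaugeDir_le_of_combSolve hM hξ0 hsol hWu (hR0 R hR) (fun z μ _ _ => hR z μ) y κ
    rw [hcastR] at h
    linarith

/-! ## §2 (L2)ʰ on all tangent fields from ONE letter on the comb slice -/

/-- **(L2)ʰ ON THE WHOLE TANGENT SLICE FROM (c₁)^{comb} + THE TENSION LETTER.**  Data: `d ≥ 1`, `L ≥ 1`, `N`, `j` with `P = N·L^{j+1} ≥ 2`, `M = L^{j+1}`; `W` unitary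
`P`-periodic of the multi-level class (`LevelSmall d L j x`, `SmallField W x`); the integrated tension letter `|dAction W K (perWin d P)| ≤ τ_W·‖K‖_{ℓ¹(periodBox P)}` for all
skew `P`-periodic `K`; (c₁)^{comb}: for every SKEW `X` VANISHING ON THE IN-BLOCK COMB BONDS (`(z mod M)_κ = 0 ∀ κ < μ`, `(z mod M)_μ + 1 < M` ⟹ `X(z,μ) = 0`), `P`-periodic and
W-tangent (`dirIter L (j+1) W X = 0`), every sup bound `R` and every `g ≥ 0` bounding its slice functional, `‖curlAt W X z μ′ ν′‖ ≤ K_G·g + K_X·R`.  THEN for EVERY W-tangent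
skew `P`-periodic `X`: `‖curlAt W X z μ′ ν′‖ ≤ K_G·g + ((1 + 2d(M−1))·K_X + 2(x + K_G·τ_W)·d(M−1))·R` on every plane `μ′ ≠ ν′`. [folklore] -/
theorem sliceLetter_hom_of_comb [Nonempty n] (hd : 1 ≤ d) {L N : ℕ} [NeZero N] (hL : 1 ≤ L) (j : ℕ) (hP : 2 ≤ N * L ^ (j + 1))
    {W : Site d → Fin d → (Matrix n n ℂ)ˣ} {x : ℝ} (hWu : IsUnitaryCfg W) (hWP : IsPeriodicCfg W ((N * L ^ (j + 1) : ℕ) : ℤ))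
    (hx : 0 ≤ x) (hs : LevelSmall d L j x) (hWx : SmallField W x)
    {τW : ℝ} (hτ : 0 ≤ τW)
    (hten : ∀ K : Site d → Fin d → Matrix n n ℂ, IsSkewDir K → IsPeriodicDir K ((N * L ^ (j + 1) : ℕ) : ℤ) →
      |dAction W K (perWin d (N * L ^ (j + 1)))| ≤ τW * dirL1 K (periodBox (d := d) (N * L ^ (j + 1))))
    {KG KX : ℝ}
    (hGcomb : ∀ X : Site d → Fin d → Matrix n n ℂ, IsSkewDir X →
      (∀ (z : Site d) (μ : Fin d), (∀ κ, κ < μ → cmod (L ^ (j + 1)) z κ = 0) → cmod (L ^ (j + 1)) z μ + 1 < ((L ^ (j + 1) : ℕ) : ℤ) → X z μ = 0) →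
      IsPeriodicDir X ((N * L ^ (j + 1) : ℕ) : ℤ) → dirIter L (j + 1) W X = 0 → ∀ R : ℝ, (∀ y κ', ‖X y κ'‖ ≤ R) → ∀ g : ℝ, 0 ≤ g →
      (∀ Y : Site d → Fin d → Matrix n n ℂ, IsSkewDir Y → IsPeriodicDir Y ((N * L ^ (j + 1) : ℕ) : ℤ) → dirIter L (j + 1) W Y = 0 →
        |hess W X Y (perWin d (N * L ^ (j + 1)))| ≤ g * dirL1 Y (periodBox (d := d) (N * L ^ (j + 1)))) →
      ∀ z μ' ν', μ' ≠ ν' → ‖curlAt W X z μ' ν'‖ ≤ KG * g + KX * R) :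
    ∀ X : Site d → Fin d → Matrix n n ℂ, IsSkewDir X → IsPeriodicDir X ((N * L ^ (j + 1) : ℕ) : ℤ) → dirIter L (j + 1) W X = 0 →
      ∀ R : ℝ, (∀ y κ', ‖X y κ'‖ ≤ R) → ∀ g : ℝ, 0 ≤ g →
      (∀ Y : Site d → Fin d → Matrix n n ℂ, IsSkewDir Y → IsPeriodicDir Y ((N * L ^ (j + 1) : ℕ) : ℤ) → dirIter L (j + 1) W Y = 0 →
        |hess W X Y (perWin d (N * L ^ (j + 1)))| ≤ g * dirL1 Y (periodBox (d := d) (N * L ^ (j + 1)))) →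
      ∀ z μ' ν', μ' ≠ ν' → ‖curlAt W X z μ' ν'‖
        ≤ KG * g + ((1 + 2 * ((d : ℝ) * ((L : ℝ) ^ (j + 1) - 1))) * KX
            + 2 * (x + KG * τW) * ((d : ℝ) * ((L : ℝ) ^ (j + 1) - 1))) * R :=
  sliceLetter_hom_of_hodge_split hL j hP hWu hWP hx hs hWx hτ hten
    {Y : Site d → Fin d → Matrix n n ℂ | IsSkewDir Y ∧ ∀ (z : Site d) (μ : Fin d), (∀ κ, κ < μ → cmod (L ^ (j + 1)) z κ = 0) →
      cmod (L ^ (j + 1)) z μ + 1 < ((L ^ (j + 1) : ℕ) : ℤ) → Y z μ = 0}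
    (fun X hX => hGcomb X hX.1 hX.2)
    (fun X hXs hXP _ => combSlice_hodge hd hL j hWu hWP X hXs hXP)

/-! ## §3 The same with the tension datum discharged from the flux-gradient radius (F141) -/

/-- **(L2)ʰ ON THE WHOLE TANGENT SLICE FROM (c₁)^{comb} AND THE CLASS DATA ALONE**: as §2 with the tension letter DISCHARGED — `τ_W := d·g_W + 12·#Plane·x²` where `g_W` is the
flux-gradient radius `‖covGrad W (flux W)‖ ≤ g_W` of the background (F141 `abs_dAction_le_of_fluxGrad`; `x ≤ 1∕4`; `B` the antisymmetric table of `flux W`). [folklore] -/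
theorem sliceLetter_hom_of_comb_fluxGrad [Nonempty n] (hd : 1 ≤ d) {L N : ℕ} [NeZero N] (hL : 1 ≤ L) (j : ℕ) (hP : 2 ≤ N * L ^ (j + 1))
    {W : Site d → Fin d → (Matrix n n ℂ)ˣ} {x : ℝ} (hWu : IsUnitaryCfg W) (hWP : IsPeriodicCfg W ((N * L ^ (j + 1) : ℕ) : ℤ))
    (hx : 0 ≤ x) (hx4 : x ≤ 1 / 4) (hs : LevelSmall d L j x) (hWx : SmallField W x)
    {B : Site d → Fin d → Fin d → Matrix n n ℂ}
    (hBF : ∀ (y : Site d) (μ ν : Fin d) (h : μ < ν), B y μ ν = flux W (y, ⟨(μ, ν), h⟩))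
    (hanti : ∀ (y : Site d) (μ ν : Fin d), B y ν μ = -B y μ ν)
    {gW : ℝ} (hgW0 : 0 ≤ gW) (hgW : ∀ (z : Site d) (κ : Fin d) (π : T4AveragingDeficitWall.Plane d), ‖covGrad W (flux W) z κ π‖ ≤ gW)
    {KG KX : ℝ}
    (hGcomb : ∀ X : Site d → Fin d → Matrix n n ℂ, IsSkewDir X →
      (∀ (z : Site d) (μ : Fin d), (∀ κ, κ < μ → cmod (L ^ (j + 1)) z κ = 0) → cmod (L ^ (j + 1)) z μ + 1 < ((L ^ (j + 1) : ℕ) : ℤ) → X z μ = 0) →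
      IsPeriodicDir X ((N * L ^ (j + 1) : ℕ) : ℤ) → dirIter L (j + 1) W X = 0 → ∀ R : ℝ, (∀ y κ', ‖X y κ'‖ ≤ R) → ∀ g : ℝ, 0 ≤ g →
      (∀ Y : Site d → Fin d → Matrix n n ℂ, IsSkewDir Y → IsPeriodicDir Y ((N * L ^ (j + 1) : ℕ) : ℤ) → dirIter L (j + 1) W Y = 0 →
        |hess W X Y (perWin d (N * L ^ (j + 1)))| ≤ g * dirL1 Y (periodBox (d := d) (N * L ^ (j + 1)))) →
      ∀ z μ' ν', μ' ≠ ν' → ‖curlAt W X z μ' ν'‖ ≤ KG * g + KX * R) :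
    ∀ X : Site d → Fin d → Matrix n n ℂ, IsSkewDir X → IsPeriodicDir X ((N * L ^ (j + 1) : ℕ) : ℤ) → dirIter L (j + 1) W X = 0 →
      ∀ R : ℝ, (∀ y κ', ‖X y κ'‖ ≤ R) → ∀ g : ℝ, 0 ≤ g →
      (∀ Y : Site d → Fin d → Matrix n n ℂ, IsSkewDir Y → IsPeriodicDir Y ((N * L ^ (j + 1) : ℕ) : ℤ) → dirIter L (j + 1) W Y = 0 →
        |hess W X Y (perWin d (N * L ^ (j + 1)))| ≤ g * dirL1 Y (periodBox (d := d) (N * L ^ (j + 1)))) →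
      ∀ z μ' ν', μ' ≠ ν' → ‖curlAt W X z μ' ν'‖
        ≤ KG * g + ((1 + 2 * ((d : ℝ) * ((L : ℝ) ^ (j + 1) - 1))) * KX
            + 2 * (x + KG * ((d : ℝ) * gW + 12 * (Fintype.card (T4AveragingDeficitWall.Plane d) : ℝ) * x ^ 2))
              * ((d : ℝ) * ((L : ℝ) ^ (j + 1) - 1))) * R := by
  have hP1 : 1 ≤ N * L ^ (j + 1) := by omega
  have hτ : 0 ≤ (d : ℝ) * gW + 12 * (Fintype.card (T4AveragingDeficitWall.Plane d) : ℝ) * x ^ 2 := by positivity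
  exact sliceLetter_hom_of_comb hd hL j hP hWu hWP hx hs hWx hτ
    (fun K hK hKP => abs_dAction_le_of_fluxGrad hP1 hWu hWP hx hx4 hWx hBF hanti hgW0 hgW hK hKP) hGcomb

end

end Summit.QuantumFields.BalabanUV.T4Continuum.NE7SliceLetterCombReduction
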